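import Summits.BirchSwinnertonDyer.Rank1Residual.Supersingular.X7VisibilityShapeFiveKinds
import Summits.BirchSwinnertonDyer.Rank1Residual.GaloisImage.CongruenceVisibilityWitness
import Literature.NumberTheory.EllipticCurves.RationalPointRankTwoCriteria
import HarnessLib

/-!
# N5 (N4) by VISIBILITY — the EXPLICIT-WITNESS shapes: X7 ∧ `r_an = 0` ∧ `surj(p)` ∧ odd `p` ∧ `ord_p #Ш_an ≤ 2` + a
# `p`-congruent partner `W'` and ONE NAMED point `P ∈ W'(ℚ) ∖ pW'(ℚ)` that is `p`-DIVISIBLE in `W'(ℚ_w)` at every place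
# the refined count would have had to PAY (Cremona–Mazur's original form; no rank count, no index)

Cell `b2b-bsdres`, supersingular family, prover A = unit `b2b-bsdres-x10b` (gen 26), X7 joint pair A side / N4 class lead.
Topic file; namespace `Summit.BirchSwinnertonDyer.Rank1Residual.Supersingular`.  THEOREMS ONLY (compositions by name of
theorems of the tree); no named fact, no definition, nothing booked; X6 / X7 stay CONSTRUCTION-SHAPED (marks of RESIDUAL-MAP
§I N4 / N5 unchanged).

HONEST FRAMING (run/shared/lean/b2b/bsd-rank1-residual/, verbatim in every file): the goal of the cell is to
DELETE the COMBINATION-SHAPED residual classes of the Birch–Swinnerton-Dyer formula for ALL analytic-rank `≤ 1`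
elliptic curves over `ℚ` — "full BSD formula for every rank `≤ 1` curve in class `C`" assembled STRICTLY from
published theorems — so that the rank-`≤ 1` remainder becomes exactly the CONSTRUCTION-SHAPED classes, which are
TYPED (missing-input `Prop`s), NOT attempted.  This is not "finishing BSD".

## Why (gen 26)

Every visibility offer of the cell so far (`X6Visibility*`, `X7Visibility*`, shapes `X6VisibilityTamDefectShape`,
`X7VisibilityRecordsC1`, `X7VisibilityShapeFiveKinds`) feeds the tree's COUNT
(`WeierstrassCurve.exists_sha_ne_zero_of_congr_of_places₅_rat`): every place of `S` is either of a free kind (i)–(v) or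
PAID by a factor `#W'(ℚ_w)[p] · #(ℤ_w/p)`, and the total must be `< p ^ rank W'`.  The visibility waves of gens 15/16
(HOME/b2b-bsdres-x10b/gen16/kit, X7-KURIHARA §19) therefore DISCARDED every congruent partner whose rank lost the count
(`STATUS=RANKLOW` / `NEEDHIGH`): e.g. the N5 cell `377982h1 @ 5` — class X7, `r_an = 0`, `ord₅ #Ш_an = 2`, `5 ∣ c₁₁` — whose
`5`-congruent partners `377982e1`, `377982g1` (Cremona, rank `2`) sit opposite the SPLIT multiplicative place `11` with
`#W(ℚ₁₁)[5] = #W'(ℚ₁₁)[5] = 25` (no free kind; paying `25` needs rank `≥ 3`).  But the count is only a pigeon-hole for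
the ORIGINAL statement (Cremona–Mazur 2000 §3, Agashe–Stein 2002 Lemma 3.6), which the tree also holds, by team n1011
(p09 GEN 9/10): `GaloisImage.VisibleWitness.exists_sha_ne_zero_of_congr_of_witness` — NAME a point `P ∈ W'(ℚ) ∖ pW'(ℚ)`
whose transported Kummer class satisfies the local condition of `W` at every `w ∈ S`; at a place where `P` is
`p`-DIVISIBLE in `W'(ℚ_w)` that class restricts to ZERO, so the place costs nothing WHATEVER the reduction types
(`…_of_exists_smul_eq`), and `p`-divisibility of a rational point in `W'(ℚ_w)` is DECIDABLE from its coordinates by the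
formal group (n1011-p09 `GaloisImage.LocalDivisibility.exists_nsmul_eq_baseChange_of_dvd_den[_of_ne]`: `w ∣ den x(P)`
at `w ∤ p`).  For `377982h1 ← 377982e1` the class of `T = P₁ + 3P₂ = (128166/121, −48406389/1331)` has `11² ∣ den x(T)`:
`T ∈ 5·W'(ℚ₁₁)` — the cell gets a per-pair theorem with NO rank binder at all (`X7VisibilityWitnessRecords01.lean`).

This file states the compositions ONCE so that the per-pair records only decide their data:
* §1 `not_mem_range_zsmul_of_reductionCert` — the binder `P ∉ pW'(ℚ)` from ONE good odd prime `ℓ₀` with `p ∣ N_{ℓ₀}`: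
  if `(N_{ℓ₀}/p) • P = (x, y)` with `ℓ₀ ∤ den x` then `P ∉ pW'(ℚ)` (else `(N/p)·P = N·R ∈ W'₁(ℚ_{ℓ₀})`, AEC VII.2.1 —
  the argument of cc-typer-2's `false_of_redCertificate_of_isOfFinAddOrder` for ONE point; the multiple is a `ℚ`-ladder
  certificate, `RationalLadder.lean`);
* §2 `X7RankZero.bsdp_of_casselsTate_of_congr_of_witness₆_of_surj` — X7 ∧ `surj(p)`: at every `w ∈ S` EITHER (a) a `p`-th
  root of `P` in `W'(ℚ_w)` OR one of the five free kinds (i)–(v) of `X7VisibilityShapeFiveKinds` (dispatch to the tree's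
  comparison lemmas verbatim as in `exists_sha_ne_zero_of_congr_of_places₅`); and the LEAN variant
  `X7RankZero.bsdp_of_casselsTate_of_congr_of_witness_of_surj` with only (a) / (i) / (v), which needs neither Tate
  uniformisation (`hU`, `hU2`) nor Fisher 2016 Thm. 4.4 (`hF44`);
  (The X6 twins — `ClassX6.irr` + `X6.bsdp_of_missingLowerBoundAt_of_analyticRank_eq_zero` in place of the X7 ends — are the obvious
  variants; not stated here: no X6 consumer yet, the N4 residue has no known partner.)
Chain: `Ш(E)[p] ≠ 0` (witness theorem; `E(ℚ)` finite of order prime to `p` by GZK + `ClassX7.irr`) ⟹ `p ∣ #Ш` ⟹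
`ord_p #Ш_an ≤ ord_p #Ш` by Cassels–Tate squareness (`missingLowerBoundAt_of_casselsTate_of_pow_dvd`, x11b) ⟹ `BSD(E,p)` by
Wuthrich 2014 Prop. 21 (`X7.bsdp_of_missingLowerBoundAt_of_surj`; NO Tamagawa hypothesis).  LOWER half by visibility, UPPER half by
Kato/Wuthrich; per pair; NOT a class theorem.

HONEST PRICE.  The witness road bites on a pair only if the localisation `W'(ℚ)/p → ∏_{w paid} W'(ℚ_w)/p` has a kernel
(a per-pair computation, EVIDENCE, done outside the kernel; the kernel re-checks the named representative).  It does not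
find partners; the N4 residue `130798a1 @ 7`, `399190l1 @ 7` (no non-isogenous `7`-congruent curve known) is untouched.

References: Cremona–Mazur 2000 §3 [CremonaMazur2000]; Agashe–Stein 2002 Lemma 3.6 [AgasheStein2002]; Mazur–Rubin 2015 Thm. 3.1
[MazurRubin2015SelmerCompanions]; Fisher 2016 Thm. 4.4 [Fisher2016Visualizing7]; Wuthrich 2014 Prop. 21 [Wuthrich2014]; Silverman AEC
VII.2.1, VII.3.1, X.4.14 [SilvermanAEC2009]; ATAEC V [SilvermanATAEC1994]; HOME/b2b-bsdres-x10b/X7-KURIHARA.md §29.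
-/

set_option autoImplicit false

noncomputable section

open scoped Classical

open WeierstrassCurve Literature.NumberTheory.EllipticCurves
  Literature.NumberTheory.EllipticCurves.Rank1Residual
  Literature.NumberTheory.EllipticCurves.Rank1Residual.Typed
  Literature.NumberTheory.EllipticCurves.Rank1Residual.X11RankOneCertificates
  Literature.NumberTheory.EllipticCurves.Wuthrich2014
  Literature.NumberTheory.EllipticCurves.Fisher2016
  Literature.NumberTheory.EllipticCurves.MazurRubin2015
  Literature.NumberTheory.GaloisRepresentations
  Summit.BirchSwinnertonDyer.BirchSwinnertonDyer.Rank1Residual.IntModel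
  Summit.BirchSwinnertonDyer.Rank1Residual.X11b
  Summit.BirchSwinnertonDyer.Rank1Residual.GaloisImage
open NumberField IsDedekindDomain Rat.HeightOneSpectrum

namespace Summit.BirchSwinnertonDyer.Rank1Residual.Supersingular

/-! ### §1. The binder `P ∉ pW'(ℚ)` from one good odd prime (reduction-kernel certificate) -/

/-- **`P ∉ p·E(ℚ)` from ONE good prime.**  `W/ℚ` globally minimal elliptic, `ℓ ∤ Δ_min(W)` a prime with
`p ∣ N_ℓ = #W̃(𝔽_ℓ)`, and `(N_ℓ / p) • P` an AFFINE point `(x, y)` with `ℓ ∤ den x` (i.e. not in the kernel of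
reduction `E₁(ℚ_ℓ)`).  Then `P` is not `p` times a rational point: `P = p • R` would give `(N_ℓ/p) • P = N_ℓ • R ∈ E₁(ℚ_ℓ)`
(`N_ℓ · E(ℚ_ℓ) ⊆ E₁(ℚ_ℓ)`, AEC VII.2.1, tree `isInReductionKernel_reductionPointCount_nsmul`), whose affine points have
`‖x‖_ℓ > 1`.  The conclusion is LITERALLY the binder `hP` of `VisibleWitness.exists_sha_ne_zero_of_congr_of_witness`; the
point equality is a `ℚ`-ladder certificate (`RationalLadder.nsmul_some_eq_of_ladderRunQ`), `N_ℓ` a schema count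
(`reductionPointCount_eq_of_intModel_countPoints`).  [cite: SilvermanAEC2009, Prop. VII.2.1] -/
theorem not_mem_range_zsmul_of_reductionCert (W : WeierstrassCurve ℚ) [W.IsElliptic] [W.IsGloballyMinimal]
    {p : ℕ} (ℓ : ℕ) [Fact ℓ.Prime] (hΔ : ¬ (ℓ : ℤ) ∣ minimalDiscriminantInt W) (hpN : p ∣ W.reductionPointCount ℓ)
    (P : W.toAffine.Point) {x y : ℚ} (h : W.toAffine.Nonsingular x y)
    (heq : (W.reductionPointCount ℓ / p) • P = .some x y h) (hden : ¬ ℓ ∣ x.den) :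
    P ∉ (zsmulAddGroupHom (p : ℤ) : W.toAffine.Point →+ W.toAffine.Point).range := by
  rintro ⟨R, hR⟩
  have hPR : P = p • R := by rw [← hR, zsmulAddGroupHom_apply, natCast_zsmul]
  have hcalc : (W.reductionPointCount ℓ / p) • P = W.reductionPointCount ℓ • R := by
    rw [hPR, ← mul_nsmul', Nat.div_mul_cancel hpN]
  have hker := W.isInReductionKernel_reductionPointCount_nsmul (p := ℓ) hΔ (W.toPadicPoint ℓ R)
  rw [← map_nsmul, ← hcalc, heq, toPadicPoint_some, isInReductionKernel_some] at hker
  exact absurd (Padic.norm_rat_le_one hden) (not_le.mpr hker)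

/-! ### §2. X7 ∧ `r_an = 0` ∧ `surj(p)`: the witness shapes -/

section Witness

variable {W W' : WeierstrassCurve ℚ} [W.IsElliptic] [W'.IsElliptic] {p : ℕ} [Fact p.Prime]

/-- Local dispatch (six options): at a place `w ∈ S`, the transported Kummer class `θ_* κ'(P)` of a rational point
`P ∈ W'(ℚ)` satisfies the local condition of `W` if EITHER (a) `P|_{ℚ_w}` has a `p`-th root in `W'(ℚ_w)`
(`VisibleWitness.h1Equiv_kummerMapTorsion_mem_selmerLocalKer_of_exists_smul_eq`) OR `w` is of one of the five free kinds
(i)–(v) of the refined count (the tree's comparison lemmas, verbatim as dispatched in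
`WeierstrassCurve.exists_sha_ne_zero_of_congr_of_places₅`; over `ℚ` the ramification clauses are automatic, `e = 1 < p − 1`).
Conditional on `hU`, `hU2` (kinds (ii)/(iii)), `hF44` (kind (iv)), `hMR` (kind (v)). [cite: MazurRubin2015SelmerCompanions, Thm. 3.1 (iv)(b) and §6 Case 5]
[cite: Fisher2016Visualizing7, Thm. 4.4 (p. 106)] [cite: CremonaMazur2000, §3] [cite: SilvermanAEC2009, Thm. X.4.14] -/
theorem h1Equiv_kummerMapTorsion_mem_selmerLocalKer_of_witness₆
    (hU : Silverman1994_thmV53_tateUniformisation.{0})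
    (hU2 : Silverman1994_thmV53_corV54_tateUniformisation.{0})
    (hF44 : thm44_selmerLocalKer_iff_of_nonsplit_good) (hMR : selmerLocalKer_iff_of_goodReduction_above)
    (hp : p ≠ 2) (θ : geomTorsion W' (p : ℤ) ≃+ geomTorsion W (p : ℤ))
    (hθ : ∀ (σ : Field.absoluteGaloisGroup ℚ) (P : geomTorsion W' (p : ℤ)), θ (σ • P) = σ • θ P)
    (hdiv' : ∀ Q : geomPoints W', ∃ R : geomPoints W', (p : ℤ) • R = Q) (P : W'.toAffine.Point)
    (w : HeightOneSpectrum (𝓞 ℚ))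
    (hw : (∃ Q : (W'.baseChange (w.adicCompletion ℚ)).toAffine.Point,
        p • Q = WeierstrassCurve.Affine.Point.baseChange (W' := W') ℚ (w.adicCompletion ℚ) P) ∨
      ((p : 𝓞 ℚ) ∉ w.asIdeal ∧ Nat.card (nsmulAddMonoidHom p :
          (W'.baseChange (w.adicCompletion ℚ)).toAffine.Point →+ _).ker = 1) ∨
      (W.HasSplitMultiplicativeReductionAt w ∧ W'.HasSplitMultiplicativeReductionAt w ∧
        Nat.card (nsmulAddMonoidHom p :
          (W.baseChange (w.adicCompletion ℚ)).toAffine.Point →+ _).ker ≤ p) ∨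
      (W.HasMultiplicativeReductionAt w ∧ W'.HasMultiplicativeReductionAt w ∧
        (∃ r : w.adicCompletion ℚ, algebraMap ℚ (w.adicCompletion ℚ) (-(W.c₄ / W.c₆)) =
          r ^ 2 * algebraMap ℚ (w.adicCompletion ℚ) (-(W'.c₄ / W'.c₆))) ∧
        (∀ ζ : w.adicCompletion ℚ, ζ ^ p = 1 → ζ = 1)) ∨
      ((W.HasMultiplicativeReductionAt w ∧ ¬ W.HasSplitMultiplicativeReductionAt w ∧
          W'.HasGoodReductionAt w) ∨
        (W.HasGoodReductionAt w ∧ W'.HasMultiplicativeReductionAt w ∧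
          ¬ W'.HasSplitMultiplicativeReductionAt w)) ∨
      ((p : 𝓞 ℚ) ∈ w.asIdeal ∧ W.HasGoodReductionAt w ∧ W'.HasGoodReductionAt w)) :
    h1Equiv θ hθ (kummerMapTorsion W' (p : ℤ) hdiv' P) ∈ selmerLocalKer W (w.adicCompletion ℚ) (p : ℤ) := by
  have hpp : p.Prime := Fact.out
  have hn : (p : ℤ) ≠ 0 := by exact_mod_cast hpp.ne_zero
  have hram : w.asIdeal.ramificationIdx ℤ < p - 1 := by
    have h1 := ramificationIdx_int_rat_eq_one w
    have h3 : 3 ≤ p := by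
      rcases hpp.eq_two_or_odd' with h' | h'
      · exact absurd h' hp
      · have := hpp.two_le; omega
    omega
  -- the Kummer class of a rational point is Selmer for `W'` everywhere
  have hc : kummerMapTorsion W' (p : ℤ) hdiv' P ∈ selmerLocalKer W' (w.adicCompletion ℚ) (p : ℤ) :=
    kummerMapTorsion_mem_selmerLocalKer W' _ hdiv' _ P
  rcases hw with ⟨Q, hQ⟩ | ⟨hwp, hloc⟩ | ⟨hWw, hW'w, hcardw⟩ | ⟨hWw, hW'w, hγw, hμw⟩ | hkind | ⟨hwp, hWw, hW'w⟩
  · -- (a): a `p`-th root of `P` in `W'(ℚ_w)` — the class restricts to zero at `w`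
    exact VisibleWitness.h1Equiv_kummerMapTorsion_mem_selmerLocalKer_of_exists_smul_eq W W' θ hθ
      (w.adicCompletion ℚ) hn hdiv' P ⟨Q, by rw [natCast_zsmul]; exact hQ⟩
  · -- kind (i): `w ∤ p`, `W'(ℚ_w)[p] = 0`
    exact (relIndex_map_selmerLocalKer_eq_one_iff W W' θ hθ).mp
      (relIndex_map_selmerLocalKer_eq_one_of_card_torsion_eq_one W W' θ hθ hwp hloc) _ hc
  · -- kind (ii): both split multiplicative, `#W(ℚ_w)[p] ≤ p` (Tate uniformisation)
    exact W.h1Equiv_mem_selmerLocalKer_of_hasSplitMultiplicativeReductionAt w hU W' θ hθ hWw hW'w hcardw hc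
  · -- kind (iii): both multiplicative of the same `γ`-class, `μ_p(ℚ_w) = 1`
    exact W.h1Equiv_mem_selmerLocalKer_of_hasMultiplicativeReductionAt w hU2 hp W' θ hθ hWw hW'w hγw hμw hc
  · -- kind (iv): one non-split multiplicative, the other good (Fisher 2016 Thm. 4.4)
    exact selmerLocalKer_le_of_nonsplit_good W hF44 hp W' θ hθ w (Or.inr hram) hkind hc
  · -- kind (v): `w ∣ p`, both good (Mazur–Rubin 2015)
    exact selmerLocalKer_le_of_goodReduction_above W hMR hp W' θ hθ w hwp hram hWw hW'w hc

/-- Local dispatch, LEAN variant (three options, no Tate uniformisation, no Fisher 2016): (a) a `p`-th root of `P` in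
`W'(ℚ_w)`, OR kind (i) `w ∤ p ∧ W'(ℚ_w)[p] = 0`, OR kind (v) `w ∣ p`, both curves good at `w` (Mazur–Rubin, `hMR`).
[cite: MazurRubin2015SelmerCompanions, Thm. 3.1 (iv)(b) and §6 Case 5] [cite: CremonaMazur2000, §3] -/
theorem h1Equiv_kummerMapTorsion_mem_selmerLocalKer_of_witness
    (hMR : selmerLocalKer_iff_of_goodReduction_above)
    (hp : p ≠ 2) (θ : geomTorsion W' (p : ℤ) ≃+ geomTorsion W (p : ℤ))
    (hθ : ∀ (σ : Field.absoluteGaloisGroup ℚ) (P : geomTorsion W' (p : ℤ)), θ (σ • P) = σ • θ P)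
    (hdiv' : ∀ Q : geomPoints W', ∃ R : geomPoints W', (p : ℤ) • R = Q) (P : W'.toAffine.Point)
    (w : HeightOneSpectrum (𝓞 ℚ))
    (hw : (∃ Q : (W'.baseChange (w.adicCompletion ℚ)).toAffine.Point,
        p • Q = WeierstrassCurve.Affine.Point.baseChange (W' := W') ℚ (w.adicCompletion ℚ) P) ∨
      ((p : 𝓞 ℚ) ∉ w.asIdeal ∧ Nat.card (nsmulAddMonoidHom p :
          (W'.baseChange (w.adicCompletion ℚ)).toAffine.Point →+ _).ker = 1) ∨
      ((p : 𝓞 ℚ) ∈ w.asIdeal ∧ W.HasGoodReductionAt w ∧ W'.HasGoodReductionAt w)) :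
    h1Equiv θ hθ (kummerMapTorsion W' (p : ℤ) hdiv' P) ∈ selmerLocalKer W (w.adicCompletion ℚ) (p : ℤ) := by
  have hpp : p.Prime := Fact.out
  have hn : (p : ℤ) ≠ 0 := by exact_mod_cast hpp.ne_zero
  have hc : kummerMapTorsion W' (p : ℤ) hdiv' P ∈ selmerLocalKer W' (w.adicCompletion ℚ) (p : ℤ) :=
    kummerMapTorsion_mem_selmerLocalKer W' _ hdiv' _ P
  rcases hw with ⟨Q, hQ⟩ | ⟨hwp, hloc⟩ | ⟨hwp, hWw, hW'w⟩
  · exact VisibleWitness.h1Equiv_kummerMapTorsion_mem_selmerLocalKer_of_exists_smul_eq W W' θ hθ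
      (w.adicCompletion ℚ) hn hdiv' P ⟨Q, by rw [natCast_zsmul]; exact hQ⟩
  · exact (relIndex_map_selmerLocalKer_eq_one_iff W W' θ hθ).mp
      (relIndex_map_selmerLocalKer_eq_one_of_card_torsion_eq_one W W' θ hθ hwp hloc) _ hc
  · have hram : w.asIdeal.ramificationIdx ℤ < p - 1 := by
      have h1 := ramificationIdx_int_rat_eq_one w
      have h3 : 3 ≤ p := by
        rcases hpp.eq_two_or_odd' with h' | h'
        · exact absurd h' hp
        · have := hpp.two_le; omega
      omega
    exact selmerLocalKer_le_of_goodReduction_above W hMR hp W' θ hθ w hwp hram hWw hW'w hc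

/-- **The visible element of `Ш(E/ℚ)[p]` from a NAMED witness** (any `W/ℚ` with `E(ℚ)` finite of order prime to `p`):
`θ : W'[p] ⥲ W[p]` a `Γ_ℚ`-isomorphism, `S` a finite set of places off which both curves are good and `w ∤ p`,
`P ∈ W'(ℚ) ∖ pW'(ℚ)`, and at every `w ∈ S` one of the six options of
`h1Equiv_kummerMapTorsion_mem_selmerLocalKer_of_witness₆`.  Then `Ш(E/ℚ)` has a non-zero element killed by `p`
(n1011-p09's `VisibleWitness.exists_sha_ne_zero_of_congr_of_witness`).  [cite: CremonaMazur2000, §3] [cite: AgasheStein2002, Lemma 3.6] -/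
theorem exists_sha_ne_zero_of_congr_of_witness₆
    (hU : Silverman1994_thmV53_tateUniformisation.{0})
    (hU2 : Silverman1994_thmV53_corV54_tateUniformisation.{0})
    (hF44 : thm44_selmerLocalKer_iff_of_nonsplit_good) (hMR : selmerLocalKer_iff_of_goodReduction_above)
    (hp : p ≠ 2) (θ : geomTorsion W' (p : ℤ) ≃+ geomTorsion W (p : ℤ))
    (hθ : ∀ (σ : Field.absoluteGaloisGroup ℚ) (P : geomTorsion W' (p : ℤ)), θ (σ • P) = σ • θ P)
    (S : Finset (HeightOneSpectrum (𝓞 ℚ)))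
    (hS : ∀ w : HeightOneSpectrum (𝓞 ℚ), w ∉ S →
      W.HasGoodReductionAt w ∧ W'.HasGoodReductionAt w ∧ (p : 𝓞 ℚ) ∉ w.asIdeal)
    (hfin : Finite W.toAffine.Point) (hcop : (Nat.card W.toAffine.Point).Coprime p)
    (P : W'.toAffine.Point)
    (hP : P ∉ (zsmulAddGroupHom (p : ℤ) : W'.toAffine.Point →+ W'.toAffine.Point).range)
    (hplaces : ∀ w ∈ S,
      (∃ Q : (W'.baseChange (w.adicCompletion ℚ)).toAffine.Point,
        p • Q = WeierstrassCurve.Affine.Point.baseChange (W' := W') ℚ (w.adicCompletion ℚ) P) ∨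
      ((p : 𝓞 ℚ) ∉ w.asIdeal ∧ Nat.card (nsmulAddMonoidHom p :
          (W'.baseChange (w.adicCompletion ℚ)).toAffine.Point →+ _).ker = 1) ∨
      (W.HasSplitMultiplicativeReductionAt w ∧ W'.HasSplitMultiplicativeReductionAt w ∧
        Nat.card (nsmulAddMonoidHom p :
          (W.baseChange (w.adicCompletion ℚ)).toAffine.Point →+ _).ker ≤ p) ∨
      (W.HasMultiplicativeReductionAt w ∧ W'.HasMultiplicativeReductionAt w ∧
        (∃ r : w.adicCompletion ℚ, algebraMap ℚ (w.adicCompletion ℚ) (-(W.c₄ / W.c₆)) =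
          r ^ 2 * algebraMap ℚ (w.adicCompletion ℚ) (-(W'.c₄ / W'.c₆))) ∧
        (∀ ζ : w.adicCompletion ℚ, ζ ^ p = 1 → ζ = 1)) ∨
      ((W.HasMultiplicativeReductionAt w ∧ ¬ W.HasSplitMultiplicativeReductionAt w ∧
          W'.HasGoodReductionAt w) ∨
        (W.HasGoodReductionAt w ∧ W'.HasMultiplicativeReductionAt w ∧
          ¬ W'.HasSplitMultiplicativeReductionAt w)) ∨
      ((p : 𝓞 ℚ) ∈ w.asIdeal ∧ W.HasGoodReductionAt w ∧ W'.HasGoodReductionAt w)) :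
    ∃ c : W.sha, c ≠ 0 ∧ p • c = 0 := by
  have hpp : p.Prime := Fact.out
  have hn : (p : ℤ) ≠ 0 := by exact_mod_cast hpp.ne_zero
  haveI := hfin
  have hdiv' : ∀ Q : geomPoints W', ∃ R : geomPoints W', (p : ℤ) • R = Q :=
    W'.zsmul_geomPoints_surjective_holds hn
  have hE : (zsmulAddGroupHom (p : ℤ) : W.toAffine.Point →+ W.toAffine.Point).range = ⊤ := by
    rw [← AddSubgroup.index_eq_one]
    exact index_range_zsmul_eq_one_of_coprime hcop
  -- the tree's witness theorem is stated for a general number field with the classical `DecidableEq`; over `ℚ` the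
  -- binders here carry `instDecidableEqRat` (the instances are equal, `Subsingleton`): `convert`.
  exact VisibleWitness.exists_sha_ne_zero_of_congr_of_witness W W' hp θ hθ S hS hdiv' (by convert hE) P
    (by convert hP) fun w hw ↦
    h1Equiv_kummerMapTorsion_mem_selmerLocalKer_of_witness₆ hU hU2 hF44 hMR hp θ hθ hdiv' P w (hplaces w hw)

/-- **The visible element of `Ш(E/ℚ)[p]` from a NAMED witness, lean variant** (options (a) / (i) / (v) only; conditional on
`hMR` alone).  [cite: CremonaMazur2000, §3] [cite: AgasheStein2002, Lemma 3.6] [cite: MazurRubin2015SelmerCompanions, Thm. 3.1 (iv)(b)] -/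
theorem exists_sha_ne_zero_of_congr_of_witness
    (hMR : selmerLocalKer_iff_of_goodReduction_above)
    (hp : p ≠ 2) (θ : geomTorsion W' (p : ℤ) ≃+ geomTorsion W (p : ℤ))
    (hθ : ∀ (σ : Field.absoluteGaloisGroup ℚ) (P : geomTorsion W' (p : ℤ)), θ (σ • P) = σ • θ P)
    (S : Finset (HeightOneSpectrum (𝓞 ℚ)))
    (hS : ∀ w : HeightOneSpectrum (𝓞 ℚ), w ∉ S →
      W.HasGoodReductionAt w ∧ W'.HasGoodReductionAt w ∧ (p : 𝓞 ℚ) ∉ w.asIdeal)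
    (hfin : Finite W.toAffine.Point) (hcop : (Nat.card W.toAffine.Point).Coprime p)
    (P : W'.toAffine.Point)
    (hP : P ∉ (zsmulAddGroupHom (p : ℤ) : W'.toAffine.Point →+ W'.toAffine.Point).range)
    (hplaces : ∀ w ∈ S,
      (∃ Q : (W'.baseChange (w.adicCompletion ℚ)).toAffine.Point,
        p • Q = WeierstrassCurve.Affine.Point.baseChange (W' := W') ℚ (w.adicCompletion ℚ) P) ∨
      ((p : 𝓞 ℚ) ∉ w.asIdeal ∧ Nat.card (nsmulAddMonoidHom p :
          (W'.baseChange (w.adicCompletion ℚ)).toAffine.Point →+ _).ker = 1) ∨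
      ((p : 𝓞 ℚ) ∈ w.asIdeal ∧ W.HasGoodReductionAt w ∧ W'.HasGoodReductionAt w)) :
    ∃ c : W.sha, c ≠ 0 ∧ p • c = 0 := by
  have hpp : p.Prime := Fact.out
  have hn : (p : ℤ) ≠ 0 := by exact_mod_cast hpp.ne_zero
  haveI := hfin
  have hdiv' : ∀ Q : geomPoints W', ∃ R : geomPoints W', (p : ℤ) • R = Q :=
    W'.zsmul_geomPoints_surjective_holds hn
  have hE : (zsmulAddGroupHom (p : ℤ) : W.toAffine.Point →+ W.toAffine.Point).range = ⊤ := by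
    rw [← AddSubgroup.index_eq_one]
    exact index_range_zsmul_eq_one_of_coprime hcop
  -- the tree's witness theorem is stated for a general number field with the classical `DecidableEq`; over `ℚ` the
  -- binders here carry `instDecidableEqRat` (the instances are equal, `Subsingleton`): `convert`.
  exact VisibleWitness.exists_sha_ne_zero_of_congr_of_witness W W' hp θ hθ S hS hdiv' (by convert hE) P
    (by convert hP) fun w hw ↦
    h1Equiv_kummerMapTorsion_mem_selmerLocalKer_of_witness hMR hp θ hθ hdiv' P w (hplaces w hw)

end Witness

/-- **X7 ∩ {r_an = 0}, odd `p`, SURJECTIVE `ρ̄_{E,p}`, `ord_p #Ш_an ≤ 2`: `BSD(E,p)` from PUBLISHED theorems plus a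
`p`-CONGRUENT curve `W'` and ONE WITNESS POINT `P ∈ W'(ℚ) ∖ pW'(ℚ)`** that, at every place of `S`, EITHER has a
`p`-th root in `W'(ℚ_w)` OR sits at a place of one of the five free kinds (i)–(v) of `X7VisibilityShapeFiveKinds`.
NO rank binder, NO count.  Chain: `exists_sha_ne_zero_of_congr_of_witness₆` (`E(ℚ)` finite of order prime to `p` by GZK +
`ClassX7.irr`) ⟹ `p ∣ #Ш` ⟹ Cassels–Tate squareness ⟹ Wuthrich Prop. 21 (`X7.bsdp_of_missingLowerBoundAt_of_surj`;
NO Tamagawa hypothesis).  Per pair; NOT a class theorem.  [cite: CremonaMazur2000, §3 and Table 1] [cite: AgasheStein2002, Lemma 3.6]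
[cite: MazurRubin2015SelmerCompanions, Thm. 3.1 (iv)(b) and §6 Case 5] [cite: Fisher2016Visualizing7, Thm. 4.4 (p. 106)]
[cite: Wuthrich2014, Prop. 21 (p. 400)] [cite: SilvermanATAEC1994, Ch. V Thm. 5.3, Cor. 5.4] [cite: SilvermanAEC2009, Thm. X.4.14] -/
theorem X7RankZero.bsdp_of_casselsTate_of_congr_of_witness₆_of_surj
    (hCT : exists_casselsTate_pairing (K := ℚ)) (hW : sha_dvd_analyticSha)
    (hGZK : rank_eq_analyticRank_of_analyticRank_le_one) (hmod : hasEntireLFunction_rat)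
    (hU : Silverman1994_thmV53_tateUniformisation.{0})
    (hU2 : Silverman1994_thmV53_corV54_tateUniformisation.{0})
    (hF44 : thm44_selmerLocalKer_iff_of_nonsplit_good) (hMR : selmerLocalKer_iff_of_goodReduction_above)
    (W : WeierstrassCurve ℚ) [W.IsElliptic] [W.IsGloballyMinimal] (p : ℕ) [Fact p.Prime] (hp : p ≠ 2)
    (hX : ClassX7 W p) (hs : Surj W p) (hr : W.analyticRank = 0) {q : ℚ} (hq : shaAn W = (q : ℂ))
    (hv : padicValRat p q ≤ 2)
    (W' : WeierstrassCurve ℚ) [W'.IsElliptic]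
    (θ : geomTorsion W' (p : ℤ) ≃+ geomTorsion W (p : ℤ))
    (hθ : ∀ (σ : Field.absoluteGaloisGroup ℚ) (P : geomTorsion W' (p : ℤ)), θ (σ • P) = σ • θ P)
    (S : Finset (HeightOneSpectrum (𝓞 ℚ)))
    (hS : ∀ w : HeightOneSpectrum (𝓞 ℚ), w ∉ S →
      W.HasGoodReductionAt w ∧ W'.HasGoodReductionAt w ∧ (p : 𝓞 ℚ) ∉ w.asIdeal)
    (P : W'.toAffine.Point)
    (hP : P ∉ (zsmulAddGroupHom (p : ℤ) : W'.toAffine.Point →+ W'.toAffine.Point).range)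
    (hplaces : ∀ w ∈ S,
      (∃ Q : (W'.baseChange (w.adicCompletion ℚ)).toAffine.Point,
        p • Q = WeierstrassCurve.Affine.Point.baseChange (W' := W') ℚ (w.adicCompletion ℚ) P) ∨
      ((p : 𝓞 ℚ) ∉ w.asIdeal ∧ Nat.card (nsmulAddMonoidHom p :
          (W'.baseChange (w.adicCompletion ℚ)).toAffine.Point →+ _).ker = 1) ∨
      (W.HasSplitMultiplicativeReductionAt w ∧ W'.HasSplitMultiplicativeReductionAt w ∧
        Nat.card (nsmulAddMonoidHom p :
          (W.baseChange (w.adicCompletion ℚ)).toAffine.Point →+ _).ker ≤ p) ∨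
      (W.HasMultiplicativeReductionAt w ∧ W'.HasMultiplicativeReductionAt w ∧
        (∃ r : w.adicCompletion ℚ, algebraMap ℚ (w.adicCompletion ℚ) (-(W.c₄ / W.c₆)) =
          r ^ 2 * algebraMap ℚ (w.adicCompletion ℚ) (-(W'.c₄ / W'.c₆))) ∧
        (∀ ζ : w.adicCompletion ℚ, ζ ^ p = 1 → ζ = 1)) ∨
      ((W.HasMultiplicativeReductionAt w ∧ ¬ W.HasSplitMultiplicativeReductionAt w ∧
          W'.HasGoodReductionAt w) ∨
        (W.HasGoodReductionAt w ∧ W'.HasMultiplicativeReductionAt w ∧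
          ¬ W'.HasSplitMultiplicativeReductionAt w)) ∨
      ((p : 𝓞 ℚ) ∈ w.asIdeal ∧ W.HasGoodReductionAt w ∧ W'.HasGoodReductionAt w)) :
    BSDp W p := by
  haveI hfin : Finite W.toAffine.Point := finite_point_of_analyticRank_eq_zero W hGZK hr
  have hirr : Irr W p := ClassX7.irr W p hp hX
  have hcop : (Nat.card W.toAffine.Point).Coprime p := coprime_natCard_point_of_irr W p hirr
  have hex : ∃ c : W.sha, c ≠ 0 ∧ p • c = 0 :=
    exists_sha_ne_zero_of_congr_of_witness₆ hU hU2 hF44 hMR hp θ hθ S hS hfin hcop P hP hplaces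
  have hfinSha : W.ShaFinite := (hGZK W (by rw [hr]; norm_num)).2
  have hlow : MissingLowerBoundAt W p :=
    missingLowerBoundAt_of_casselsTate_of_pow_dvd W p hCT hfinSha hq (k := 1) (by simpa using hv)
      (by simpa using dvd_shaOrder_of_exists_torsion W p hex)
  exact X7.bsdp_of_missingLowerBoundAt_of_surj W p hW hGZK hmod hp hX hs hr hlow

/-- **X7 ∩ {r_an = 0}, odd `p`, `surj(p)`, `ord_p #Ш_an ≤ 2`: `BSD(E,p)` from a `p`-congruent partner and ONE WITNESS POINT —
LEAN variant**: every place of `S` is (a) a place where the witness has a `p`-th root in `W'(ℚ_w)`, or (i) `w ∤ p` with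
`W'(ℚ_w)[p] = 0`, or (v) the place of `p` with both curves good (Mazur–Rubin).  Named facts: Cassels–Tate, Wuthrich Prop. 21,
GZK, modularity, Mazur–Rubin 2015 — NO Tate uniformisation, NO Fisher 2016, NO rank binder.  Per pair; NOT a class theorem.
[cite: CremonaMazur2000, §3 and Table 1] [cite: AgasheStein2002, Lemma 3.6] [cite: MazurRubin2015SelmerCompanions, Thm. 3.1 (iv)(b) and §6 Case 5]
[cite: Wuthrich2014, Prop. 21 (p. 400)] [cite: SilvermanAEC2009, Thm. X.4.14] -/
theorem X7RankZero.bsdp_of_casselsTate_of_congr_of_witness_of_surj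
    (hCT : exists_casselsTate_pairing (K := ℚ)) (hW : sha_dvd_analyticSha)
    (hGZK : rank_eq_analyticRank_of_analyticRank_le_one) (hmod : hasEntireLFunction_rat)
    (hMR : selmerLocalKer_iff_of_goodReduction_above)
    (W : WeierstrassCurve ℚ) [W.IsElliptic] [W.IsGloballyMinimal] (p : ℕ) [Fact p.Prime] (hp : p ≠ 2)
    (hX : ClassX7 W p) (hs : Surj W p) (hr : W.analyticRank = 0) {q : ℚ} (hq : shaAn W = (q : ℂ))
    (hv : padicValRat p q ≤ 2)
    (W' : WeierstrassCurve ℚ) [W'.IsElliptic]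
    (θ : geomTorsion W' (p : ℤ) ≃+ geomTorsion W (p : ℤ))
    (hθ : ∀ (σ : Field.absoluteGaloisGroup ℚ) (P : geomTorsion W' (p : ℤ)), θ (σ • P) = σ • θ P)
    (S : Finset (HeightOneSpectrum (𝓞 ℚ)))
    (hS : ∀ w : HeightOneSpectrum (𝓞 ℚ), w ∉ S →
      W.HasGoodReductionAt w ∧ W'.HasGoodReductionAt w ∧ (p : 𝓞 ℚ) ∉ w.asIdeal)
    (P : W'.toAffine.Point)
    (hP : P ∉ (zsmulAddGroupHom (p : ℤ) : W'.toAffine.Point →+ W'.toAffine.Point).range)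
    (hplaces : ∀ w ∈ S,
      (∃ Q : (W'.baseChange (w.adicCompletion ℚ)).toAffine.Point,
        p • Q = WeierstrassCurve.Affine.Point.baseChange (W' := W') ℚ (w.adicCompletion ℚ) P) ∨
      ((p : 𝓞 ℚ) ∉ w.asIdeal ∧ Nat.card (nsmulAddMonoidHom p :
          (W'.baseChange (w.adicCompletion ℚ)).toAffine.Point →+ _).ker = 1) ∨
      ((p : 𝓞 ℚ) ∈ w.asIdeal ∧ W.HasGoodReductionAt w ∧ W'.HasGoodReductionAt w)) :
    BSDp W p := by
  haveI hfin : Finite W.toAffine.Point := finite_point_of_analyticRank_eq_zero W hGZK hr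
  have hirr : Irr W p := ClassX7.irr W p hp hX
  have hcop : (Nat.card W.toAffine.Point).Coprime p := coprime_natCard_point_of_irr W p hirr
  have hex : ∃ c : W.sha, c ≠ 0 ∧ p • c = 0 :=
    exists_sha_ne_zero_of_congr_of_witness hMR hp θ hθ S hS hfin hcop P hP hplaces
  have hfinSha : W.ShaFinite := (hGZK W (by rw [hr]; norm_num)).2
  have hlow : MissingLowerBoundAt W p :=
    missingLowerBoundAt_of_casselsTate_of_pow_dvd W p hCT hfinSha hq (k := 1) (by simpa using hv)
      (by simpa using dvd_shaOrder_of_exists_torsion W p hex)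
  exact X7.bsdp_of_missingLowerBoundAt_of_surj W p hW hGZK hmod hp hX hs hr hlow

end Summit.BirchSwinnertonDyer.Rank1Residual.Supersingular

end
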